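import Literature.NumberTheory.EllipticCurves.Sprung2024.ChromaticLocalInjectivity
import Literature.NumberTheory.EllipticCurves.Sprung2012.ColemanMapImage
import Literature.NumberTheory.EllipticCurves.Sprung2012.ColemanTwistProofs
import Literature.Algebra.Module.PadicFunctionalSeparation
import HarnessLib

/-!
# Sprung 2024, §5.2, proof of Lemma 5.5, case `v = p` ("`r_p` is injective") — PROVED modulo
# Sprung 2012's formal-group layer: `lem55[AllN]_sharpFlat_localKerOver_of_layerToInfty_mem` from
# Prop. 7.3 (`Col♭` onto `Λ`), Prop. 7.6 (`η = 1`: `Col♯` onto `Λ`) and Lemma 2.3 (no `p`-torsion)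

`Proofs` file (theorems only: **no definition, no named fact**), topic
`Literature/NumberTheory/EllipticCurves`, cluster `Sprung2024`. It turns the two NAMED FACTS of
`Sprung2024/ChromaticLocalInjectivity.lean` (F. Sprung, Adv. Math. **449** (2024) 109741, §5.2,
proof of Lemma 5.5, case `v = p`, p. 40: "We want to show that the map
`H¹(ℚ_p, E[p^∞]) / E(ℚ_p) ⊗ ℚ_p/ℤ_p ⟶(r_p) H¹(ℚ_{p,∞}, E[p^∞]) / E⋆_{∞,p}` is injective … consider
the following commutative diagram … `(ker Col⋆_p)_X → (H¹_Iw)_X → (H¹_Iw / ker Col⋆_p)_X → 0` over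
`0 → ker Col⋆_{p,0} → H¹(k_0, T) → H¹(k_0, T)/ker Col⋆_{p,0}` … By construction, the right vertical
map is an isomorphism. The middle vertical map is a surjection by [64, Lemma 2.3]. The snake lemma
thus shows that the left vertical map is surjective. Taking Pontryagin duals, we see that `r_p` is
injective, as claimed.") into KERNEL THEOREMS conditional on the three named facts of
`Sprung2012/ColemanMapImage.lean` — Sprung 2012 Prop. 7.3, Prop. 7.6 (first sentence) and Lemma 2.3,
i.e. exactly the inputs the printed sentence uses ("By construction … is an isomorphism" ⟸
`Im Col⋆ = Λ`; "[64, Lemma 2.3]"):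

* `lem55AllN_of_colemanSurjective : prop73_… → prop76_… → lem23_… → lem55AllN_…`,
* `lem55_of_colemanSurjective : prop73_… → prop76_… → lem23_… → lem55_…` (the printed,
  square-free form; the binder `W.IsSemistable (𝓞 ℚ)` is not used).

The engine `mem_localKerOver_of_layerToInfty_mem_sharpFlatLocalKummerOverOfEmb` is stated for any
number field `K`, completion `K_v`, `ℤ_p`-extension `κ`, local lift `g`, Honda system and colour,
with the surjectivity of `Col^•` and the absence of `p`-torsion in `E(K_∞·K_v)` as hypotheses. The
argument, in the tree's transcription (`H¹_Iw(T)` = functionals `z` on `M = E(K_∞·K_v)`,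
`E⋆_{∞,𝔭}` = Kummer classes `x ⊗ p^{-k}` with `p^k ∣ z(x)` for all `z ∈ Ker Col⋆`):
1. (unpacking) the class `y = [Φ] ∈ H¹(K, E[p^∞])` restricts on `G_{∞} = Gal(K̄_v/K_∞·K_v)` to the
   Kummer cocycle of `Q`, `x = p^k Q ∈ M`, `Ker Col⋆ ⊥ x ⊗ p^{-k}` (after absorbing the coboundary
   relating the two cocycle representatives, `oneCocycleClass_eq_zero_iff`);
2. (invariance) `w₀ := gQ − Q − Φ(g)` is `G_∞`-fixed and `g x − x = p^k w₀` (the torsion point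
   `p^k Φ(g) ∈ M` vanishes by Lemma 2.3);
3. (duality, dual side) every functional `z` on `M` vanishing on `E(K_v)` is `z₁ + (w ∘ g⁻¹ − w)`
   with `z₁ ∈ Ker Col⋆` — `Sprung2012.exists_mem_colemanKer_add_twist_of_apply_layer_zero`
   (`ColemanTwistProofs.lean`, from the surjectivity of `Col⋆`: the dual of "`(ker Col⋆_p)_X →
   ker Col⋆_{p,0}` is surjective") — hence `p^k ∣ z(x)` (`z₁` by hypothesis, the twist part by 2.);
4. (duality, Pontryagin) so `x ∈ E(K_v) + p^k M` —
   `Literature.Algebra.Module.exists_nsmul_eq_of_forall_addMonoidHom_padicInt_dvd` applied to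
   `M / E(K_v)`, which is `p`-torsion-free by Lemma 2.3 ("Taking Pontryagin duals");
5. (descent) replacing `Q` by `Q − R` (`x = x₀ + p^k R`), the local cocycle of `y` minus the
   coboundary of `Q − R` vanishes on `G_∞`, takes `G_∞`-fixed `p`-power-torsion values, hence
   vanishes (Lemma 2.3): `loc_v y` is a coboundary, i.e. `y ∈ localKerOver`.

HONEST FRAMING (cell `bsd-ssimc`, seat `bsd-ssimc-k3c5-kdot-split` g6, object «KDOT-L55-KERNEL»,
route K3 `SignedLowerHalves`, crux `SprungLowerHalfAtThree` = stmt-BirchSwinnertonDyer-19003, split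
child K2 = stmt-BirchSwinnertonDyer-19877): the two `lem55…` facts become theorems CONDITIONAL on
three verbatim, local, flag-free Sprung 2012 statements (no `_holds` for `lem55…`: they stay named
facts on the ledger until Prop. 7.3 / 7.6 / Lemma 2.3 are discharged); the flag
`Sprung24-§5.2-L5.5p-allN-local` is no longer load-bearing on any road that takes the Sprung 2012
facts instead. Nothing about any curve is asserted; no census cell moves; BSD is not proved by any
of this.

## References
* [Sprung2024] §5.2 pp. 39–40 (setting; Lemma 5.5 and proof, case `v = p`); arXiv:1610.10017 §4 p. 15.
* [Sprung2012] Lemma 2.3 (p. 1487), Def. 3.1 (p. 1489), Def. 7.1–7.2, Prop. 7.3 (p. 1500), Prop. 7.6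
  (p. 1501), Def. 7.9, Lemma 7.10 (p. 1503).
* [Kobayashi2003] proof of Prop. 9.2; [GreenbergLNM1716] §2–§3 (local conditions, Lemma 3.4's
  ordinary analogue); [NeukirchSchmidtWingberg2008] I §1 (Pontryagin duality).

## Design
Theorems only; `noncomputable section`; `open scoped Classical`; one universe `u`; the engine in
`namespace Literature.NumberTheory.EllipticCurves.Sprung2024` over a number field `K`, then the two
`ℚ`-specialisations in the binder shape of the named facts.
-/

noncomputable section

open scoped Classical NumberField

open NumberField IsDedekindDomain Polynomial

universe u

namespace Literature.NumberTheory.EllipticCurves.Sprung2024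

open Literature.NumberTheory.EllipticCurves Literature.NumberTheory.GaloisRepresentations
  WeierstrassCurve ZpExtension Literature.NumberTheory.EllipticCurves.Kobayashi2003
  Literature.NumberTheory.EllipticCurves.Sprung2017 Literature.NumberTheory.EllipticCurves.Sprung2012

variable {K : Type u} [Field K] [NumberField K] (W : WeierstrassCurve K) {p : ℕ} [Fact p.Prime]
  (κ : ZpExtension K p) (E : Type u) [Field E] [Algebra K E]

/-! ## §1 Small helpers -/

/-- The layer subgroups `Gal(K̄/K_n)` are compact. [folklore] -/
private theorem compactSpace_layerSubgroup'' (n : ℕ) : CompactSpace (κ.layerSubgroup n) := by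
  haveI : CompactSpace (Field.absoluteGaloisGroup K) := compactSpace_absoluteGaloisGroup K
  exact isCompact_iff_compactSpace.mp
    (Subgroup.isClosed_of_isOpen _ (κ.isOpen_layerSubgroup n)).isCompact

omit [NumberField K] in
/-- No `p`-torsion ⟹ no `p`-power torsion in `E(K_∞·K_v)`. [folklore] -/
private theorem eq_zero_of_pow_smul_eq_zero
    {ι : AlgebraicClosure K →ₐ[K] AlgebraicClosure E}
    (hnt : ∀ P ∈ localTowerPointsOfEmb κ ι W, p • P = 0 → P = 0)
    {m : ℕ} {P : localPoints W E} (hP : P ∈ localTowerPointsOfEmb κ ι W) (h : p ^ m • P = 0) :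
    P = 0 := by
  induction m generalizing P with
  | zero => rwa [pow_zero, one_smul] at h
  | succ m ih =>
    have h1 : p ^ m • P ∈ localTowerPointsOfEmb κ ι W := AddSubgroup.nsmul_mem _ hP _
    have h2 : p • (p ^ m • P) = 0 := by rw [← mul_smul, ← pow_succ']; exact h
    exact ih hP (hnt _ h1 h2)

omit [NumberField K] in
/-- A Galois element commutes with multiplication by `n` on local points. [folklore] -/
private theorem galois_smul_nsmul (τ : Field.absoluteGaloisGroup E) (n : ℕ) (P : localPoints W E) :
    τ • (n • P) = n • (τ • P) :=
  map_nsmul (DistribSMul.toAddMonoidHom (localPoints W E) τ) n P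

/-! ## §2 The engine -/

/-- **Sprung 2024, Lemma 5.5 case `v = p`, in the tree's transcription, for any number field.** Let
`K` be a number field, `E/K` elliptic, `K_v` a completion (`E` below, embedding `ι = closureEmb`),
`κ` a `ℤ_p`-extension, `g ∈ Γ_{K_v}` restricting to a topological generator, `(cneg, c)` a Honda
system for `ap` with `p ∣ ap`, `⋆` a colour. ASSUME (i) `Col⋆` is surjective (`hsurj`: every `f ∈ Λ`
is the `⋆`-Coleman value of a functional — Sprung 2012 Prop. 7.3 / 7.6) and (ii) `E(K_∞·K_v)` has no
`p`-torsion (`hnt` — Sprung 2012 Lemma 2.3). THEN for every `y ∈ H¹(K, E[p^∞])` whose restriction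
to `K_∞` satisfies the `⋆`-condition at `𝔭` (`sharpFlatLocalKummerOverOfEmb … (colemanKer … ⋆)`),
`y` satisfies the classical local condition at `v` (`localKerOver`). Proof: module docstring, 1–5.
[cite: Sprung2024, §5.2 proof of Lemma 5.5, case v = p (p. 40)] [cite: Kobayashi2003, proof of Prop. 9.2]
[cite: Sprung2012, Prop. 7.3 (p. 1500), Prop. 7.6 (p. 1501), Lemma 2.3 (p. 1487), Def. 7.9 (p. 1503)] -/
theorem mem_localKerOver_of_layerToInfty_mem_sharpFlatLocalKummerOverOfEmb {ap : ℤ}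
    (hap : (p : ℤ) ∣ ap) {g : Field.absoluteGaloisGroup E}
    (hg : κ.IsTopGenerator (resGalOfEmb (closureEmb (K := K) E) g))
    {cneg : localPoints W E} {c : ℕ → localPoints W E}
    (hH : IsHondaSystem κ (closureEmb (K := K) E) W ap g cneg c) (col : Chroma)
    (hsurj : ∀ f : IwasawaAlgebra p,
      ∃ (w : localTowerPointsOfEmb κ (closureEmb (K := K) E) W →+ ℤ_[p]) (Ls Lf : IwasawaAlgebra p),
        IsColemanPair κ (closureEmb (K := K) E) W ap g c w Ls Lf ∧ chromaticL col Ls Lf = f)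
    (hnt : ∀ P ∈ localTowerPointsOfEmb κ (closureEmb (K := K) E) W, p • P = 0 → P = 0)
    {y : W.subgroupH1 p (κ.layerSubgroup 0)}
    (hy : W.layerToInfty κ 0 y ∈ sharpFlatLocalKummerOverOfEmb W p κ.kerSubgroup
        (closureEmb (K := K) E) (localTowerPointsOfEmb κ (closureEmb (K := K) E) W)
        (colemanKer κ (closureEmb (K := K) E) W ap g c col)) :
    y ∈ W.localKerOver p (κ.layerSubgroup 0) E := by
  -- notation
  set ι : AlgebraicClosure K →ₐ[K] AlgebraicClosure E := closureEmb (K := K) E with hι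
  set M : AddSubgroup (localPoints W E) := localTowerPointsOfEmb κ ι W with hM
  haveI : CompactSpace (κ.layerSubgroup 0) := compactSpace_layerSubgroup'' κ 0
  have hle0 : localLayerPointsOfEmb κ ι W 0 ≤ M := localLayerPointsOfEmb_le_localTowerPointsOfEmb κ ι W 0
  have hmem0 : ∀ σ : Field.absoluteGaloisGroup E, resGalOfEmb ι σ ∈ κ.layerSubgroup 0 := fun σ ↦ by
    rw [ZpExtension.layerSubgroup_zero]; exact Subgroup.mem_top _
  have hM0 : ∀ {P : localPoints W E}, P ∈ localLayerPointsOfEmb κ ι W 0 ↔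
      ∀ τ : Field.absoluteGaloisGroup E, τ • P = P := fun {P} ↦ mem_localLayerPointsOfEmb_zero_iff κ ι W P
  have hMfix : ∀ {P : localPoints W E}, P ∈ M →
      ∀ τ : Field.absoluteGaloisGroup E, τ ∈ localSubgroupOfEmb κ.kerSubgroup ι → τ • P = P :=
    fun {P} hP ↦ (mem_localTowerPointsOfEmb_iff κ ι W P).1 hP
  have hMsmul : ∀ (σ : Field.absoluteGaloisGroup E) {P : localPoints W E}, P ∈ M → σ • P ∈ M :=
    fun σ {P} hP ↦ smul_mem_localTowerPointsOfEmb κ ι W σ hP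
  -- normality of `G_∞ = localSubgroupOfEmb (ker κ) ι` in `Γ_{K_v}`
  have hconj : ∀ (σ τ : Field.absoluteGaloisGroup E), τ ∈ localSubgroupOfEmb κ.kerSubgroup ι →
      σ⁻¹ * τ * σ ∈ localSubgroupOfEmb κ.kerSubgroup ι := by
    intro σ τ hτ
    rw [mem_localSubgroupOfEmb_iff] at hτ ⊢
    rw [map_mul, map_mul, map_inv]
    exact κ.kerSubgroup_normal.conj_mem' _ hτ _
  -- Step 0: a cocycle `Φ` for `y` and its local values `f σ = ι_* Φ(res σ)`
  obtain ⟨Φ, rfl⟩ := oneCocycleClass_surjective (discreteTopRep (κ.layerSubgroup 0) (W.geomPrimaryTorsion p)) y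
  set f : Field.absoluteGaloisGroup E → localPoints W E := fun σ ↦
    pointsMapOfEmb W ι ((Φ.1 ⟨resGalOfEmb ι σ, hmem0 σ⟩ : W.geomPrimaryTorsion p) : W.geomPoints)
    with hf
  -- cocycle identity for `f`
  have hfmul : ∀ σ τ : Field.absoluteGaloisGroup E, f (σ * τ) = f σ + σ • f τ := by
    intro σ τ
    have hst : (⟨resGalOfEmb ι (σ * τ), hmem0 (σ * τ)⟩ : κ.layerSubgroup 0) =
        ⟨resGalOfEmb ι σ, hmem0 σ⟩ * ⟨resGalOfEmb ι τ, hmem0 τ⟩ := Subtype.ext (map_mul _ _ _)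
    have h := Φ.2 ⟨resGalOfEmb ι σ, hmem0 σ⟩ ⟨resGalOfEmb ι τ, hmem0 τ⟩
    simp only [hf]
    rw [hst, h, AddSubgroup.coe_add, map_add, discreteTopRep_ρ_apply, Subgroup.smul_def,
      primaryComponent.coe_smul, pointsMapOfEmb_smul]
  -- a uniform power of `p` killing `Φ` (compactness), hence `f`
  have hΦtors : ∀ h : κ.layerSubgroup 0, ∃ k : ℕ, p ^ k • Φ.1 h = 0 := fun h ↦ by
    obtain ⟨k, hk⟩ := AddCommGroup.mem_primaryComponent.mp (Φ.1 h).2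
    exact ⟨k, Subtype.ext (by rw [AddSubmonoidClass.coe_nsmul, hk, ZeroMemClass.coe_zero])⟩
  obtain ⟨N, hN⟩ := exists_pow_smul_apply_eq_zero Φ.1 hΦtors
  have hfN : ∀ σ : Field.absoluteGaloisGroup E, p ^ N • f σ = 0 := by
    intro σ
    simp only [hf]
    rw [← map_nsmul, ← AddSubmonoidClass.coe_nsmul, hN, ZeroMemClass.coe_zero, map_zero]
  -- Step 1: unpack the ⋆-condition and absorb the coboundary between the two representatives
  obtain ⟨φ, Q, k, hQM, hφ, hdiv, hcob⟩ := hy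
  have hres : W.layerToInfty κ 0 (oneCocycleClass _ Φ) =
      oneCocycleClass _ (contOneCocycles.pullback (subgroupInclusion (κ.kerSubgroup_le_layerSubgroup 0))
        (resHomOfEquivariant (subgroupInclusion (κ.kerSubgroup_le_layerSubgroup 0))
          (AddMonoidHom.id (W.geomPrimaryTorsion p)) (fun _ _ ↦ rfl)) Φ) :=
    map_oneCocycleClass _ _ _ Φ
  rw [hres, ← sub_eq_zero, ← oneCocycleClass_sub, oneCocycleClass_eq_zero_iff] at hφ
  obtain ⟨R₀, hR₀⟩ := hφ
  -- `φ h = Φ h + (h R₀ − R₀)` for `h ∈ ker κ`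
  have hφΦ : ∀ h : κ.kerSubgroup, (φ.1 h : W.geomPrimaryTorsion p) =
      Φ.1 ⟨(h : Field.absoluteGaloisGroup K), κ.kerSubgroup_le_layerSubgroup 0 h.2⟩ +
        ((h : Field.absoluteGaloisGroup K) • R₀ - R₀) := by
    intro h
    have hpb : (contOneCocycles.pullback (subgroupInclusion (κ.kerSubgroup_le_layerSubgroup 0))
        (resHomOfEquivariant (subgroupInclusion (κ.kerSubgroup_le_layerSubgroup 0))
          (AddMonoidHom.id (W.geomPrimaryTorsion p)) (fun _ _ ↦ rfl)) Φ).1 h =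
        Φ.1 ⟨(h : Field.absoluteGaloisGroup K), κ.kerSubgroup_le_layerSubgroup 0 h.2⟩ := by
      rw [contOneCocycles.pullback_apply]; rfl
    have h1 := hR₀ h
    rw [Submodule.coe_sub, ContinuousMap.sub_apply, hpb, sub_eq_iff_eq_add, discreteTopRep_ρ_apply,
      Subgroup.smul_def] at h1
    rw [h1, add_comm]
  -- a power of `p` killing `R₀`
  obtain ⟨m₀, hm₀⟩ : ∃ m₀ : ℕ, p ^ m₀ • R₀ = 0 := by
    obtain ⟨m, hm⟩ := AddCommGroup.mem_primaryComponent.mp R₀.2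
    exact ⟨m, Subtype.ext (by rw [AddSubmonoidClass.coe_nsmul, hm, ZeroMemClass.coe_zero])⟩
  -- the corrected point `Q₁`, exponent `k' = k + m₀`, `x' = p^{k'} Q₁ = p^{m₀} x ∈ M`
  set R₀' : localPoints W E := pointsMapOfEmb W ι ((R₀ : W.geomPrimaryTorsion p) : W.geomPoints) with hR₀'
  have hR₀'tors : p ^ m₀ • R₀' = 0 := by
    rw [hR₀', ← map_nsmul, ← AddSubmonoidClass.coe_nsmul, hm₀, ZeroMemClass.coe_zero, map_zero]
  set Q₁ : localPoints W E := Q - R₀' with hQ₁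
  set k' : ℕ := k + m₀ with hk'
  set x' : localPoints W E := p ^ k' • Q₁ with hx'
  have hx'eq : x' = p ^ m₀ • (p ^ k • Q) := by
    have e1 : p ^ k' • R₀' = 0 := by rw [hk', pow_add, mul_smul, hR₀'tors, smul_zero]
    rw [hx', hQ₁, smul_sub, e1, sub_zero, hk', pow_add, mul_comm, mul_smul]
  have hx'M : x' ∈ M := by rw [hx'eq]; exact AddSubgroup.nsmul_mem _ hQM _
  -- `f τ = τ Q₁ − Q₁` on `G_∞`
  have hfcob : ∀ τ : Field.absoluteGaloisGroup E, τ ∈ localSubgroupOfEmb κ.kerSubgroup ι →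
      f τ = τ • Q₁ - Q₁ := by
    intro τ hτ
    have h1 := hcob ⟨τ, hτ⟩
    change pointsMapOfEmb W ι _ = τ • Q - Q at h1
    have h2 := hφΦ (resGalSubgroupOfEmb κ.kerSubgroup ι ⟨τ, hτ⟩)
    have h3 : f τ = pointsMapOfEmb W ι ((Φ.1
        ⟨((resGalSubgroupOfEmb κ.kerSubgroup ι ⟨τ, hτ⟩ : κ.kerSubgroup) : Field.absoluteGaloisGroup K),
          κ.kerSubgroup_le_layerSubgroup 0 (resGalSubgroupOfEmb κ.kerSubgroup ι ⟨τ, hτ⟩).2⟩ :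
        W.geomPrimaryTorsion p) : W.geomPoints) := rfl
    have h4 : Φ.1 ⟨((resGalSubgroupOfEmb κ.kerSubgroup ι ⟨τ, hτ⟩ : κ.kerSubgroup) :
          Field.absoluteGaloisGroup K),
          κ.kerSubgroup_le_layerSubgroup 0 (resGalSubgroupOfEmb κ.kerSubgroup ι ⟨τ, hτ⟩).2⟩ =
        φ.1 (resGalSubgroupOfEmb κ.kerSubgroup ι ⟨τ, hτ⟩) -
          (((resGalSubgroupOfEmb κ.kerSubgroup ι ⟨τ, hτ⟩ : κ.kerSubgroup) :
            Field.absoluteGaloisGroup K) • R₀ - R₀) := by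
      rw [h2]; abel
    rw [h3, h4, AddSubgroup.coe_sub, map_sub, h1, AddSubgroup.coe_sub, map_sub,
      primaryComponent.coe_smul, resGalSubgroupOfEmb_apply_coe, pointsMapOfEmb_smul, hQ₁, smul_sub]
    abel
  -- divisibility hypothesis transported to `x'`
  have hdiv' : ∀ z ∈ colemanKer κ ι W ap g c col, (p : ℤ_[p]) ^ k' ∣ z ⟨x', hx'M⟩ := by
    intro z hz
    have h1 : (⟨x', hx'M⟩ : M) = p ^ m₀ • ⟨p ^ k • Q, hQM⟩ := Subtype.ext (by
      rw [AddSubmonoidClass.coe_nsmul]; exact hx'eq)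
    rw [h1, map_nsmul, nsmul_eq_mul, Nat.cast_pow, hk', pow_add, mul_comm ((p : ℤ_[p]) ^ k)]
    exact mul_dvd_mul_left _ (hdiv z hz)
  -- Step 2: invariance — `w₀ := g Q₁ − Q₁ − f g ∈ M` and `g x' − x' = p^{k'} w₀`
  set w₀ : localPoints W E := g • Q₁ - Q₁ - f g with hw₀
  have hw₀M : w₀ ∈ M := by
    rw [hM, mem_localTowerPointsOfEmb_iff]
    intro τ hτ
    have hτ' := hconj g τ hτ
    -- `f (τ g) = f τ + τ f g` and `τ g = g (g⁻¹ τ g)`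
    have e1 : f (τ * g) = f τ + τ • f g := hfmul τ g
    have e2 : f (τ * g) = f g + g • f (g⁻¹ * τ * g) := by
      rw [show τ * g = g * (g⁻¹ * τ * g) by group]; exact hfmul g _
    rw [hfcob τ hτ] at e1
    rw [hfcob _ hτ', smul_sub, ← mul_smul, show g * (g⁻¹ * τ * g) = τ * g by group, mul_smul] at e2
    -- `τ Q₁ − Q₁ + τ f g = f g + (τ g Q₁ − g Q₁)`
    have key := e1.symm.trans e2
    rw [smul_sub, smul_sub]
    calc τ • g • Q₁ - τ • Q₁ - τ • f g
        = τ • g • Q₁ - (τ • Q₁ - Q₁ + τ • f g) - Q₁ := by abel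
      _ = τ • g • Q₁ - (f g + (τ • g • Q₁ - g • Q₁)) - Q₁ := by rw [key]
      _ = g • Q₁ - Q₁ - f g := by abel
  have hgx' : g • x' - x' = p ^ k' • w₀ := by
    -- `p^{k'} w₀ = g x' − x' − p^{k'} f g`, and `p^{k'} f g ∈ M` is `p`-power torsion, hence `0`
    have e1 : p ^ k' • w₀ = g • x' - x' - p ^ k' • f g := by
      rw [hw₀, smul_sub, smul_sub, hx', galois_smul_nsmul]
    have htM : p ^ k' • f g ∈ M := by
      have : p ^ k' • f g = g • x' - x' - p ^ k' • w₀ := by rw [e1]; abel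
      rw [this]
      exact sub_mem (sub_mem (hMsmul g hx'M) hx'M) (AddSubgroup.nsmul_mem _ hw₀M _)
    have ht0 : p ^ k' • f g = 0 :=
      eq_zero_of_pow_smul_eq_zero W κ E hnt htM (m := N) (by rw [smul_comm, hfN, smul_zero])
    rw [e1, ht0, sub_zero]
  -- Step 3: every functional on `M` vanishing on `E(K_v)` is divisible by `p^{k'}` at `x'`
  have hdivAnn : ∀ z : M →+ ℤ_[p], (∀ (x : localPoints W E) (hx : x ∈ localLayerPointsOfEmb κ ι W 0),
      z ⟨x, hle0 hx⟩ = 0) → (p : ℤ_[p]) ^ k' ∣ z ⟨x', hx'M⟩ := by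
    intro z hz0
    obtain ⟨z₁, w, hz₁, hzw⟩ :=
      exists_mem_colemanKer_add_twist_of_apply_layer_zero κ ι W hap hg hH col hsurj hz0
    rw [hzw ⟨x', hx'M⟩]
    refine dvd_add (hdiv' z₁ hz₁) ?_
    -- `w(g⁻¹ x') − w(x') = w(g⁻¹ x' − x') = −p^{k'} w(g⁻¹ w₀)`
    have e1 : g⁻¹ • x' - x' = -(p ^ k' • (g⁻¹ • w₀)) := by
      rw [← galois_smul_nsmul, ← hgx', smul_sub, inv_smul_smul]; abel
    have e2 : ∀ h1 : g⁻¹ • x' ∈ M, (⟨g⁻¹ • x', h1⟩ : M) - ⟨x', hx'M⟩ =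
        -(p ^ k' • ⟨g⁻¹ • w₀, hMsmul g⁻¹ hw₀M⟩) := fun h1 ↦ Subtype.ext (by
      rw [AddSubgroup.coe_sub, AddSubgroup.coe_neg, AddSubmonoidClass.coe_nsmul]; exact e1)
    change (p : ℤ_[p]) ^ k' ∣ w ⟨g⁻¹ • x', _⟩ - w ⟨x', hx'M⟩
    rw [← map_sub, e2, map_neg, map_nsmul, nsmul_eq_mul, Nat.cast_pow]
    exact (dvd_neg).mpr (dvd_mul_right _ _)
  -- Step 4: Pontryagin separation in `M / E(K_v)` — `x' = p^{k'} R + x₀`, `x₀ ∈ E(K_v)`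
  set M₀' : AddSubgroup M := (localLayerPointsOfEmb κ ι W 0).addSubgroupOf M with hM₀'
  have hM₀'mem : ∀ {m : M}, m ∈ M₀' ↔ (m : localPoints W E) ∈ localLayerPointsOfEmb κ ι W 0 :=
    fun {m} ↦ AddSubgroup.mem_addSubgroupOf
  have hNtf : ∀ n : M ⧸ M₀', p • n = 0 → n = 0 := by
    intro n hn
    induction n using QuotientAddGroup.induction_on with
    | H m =>
      rw [← QuotientAddGroup.mk_nsmul, QuotientAddGroup.eq_zero_iff, hM₀'mem, hM0] at hn
      rw [QuotientAddGroup.eq_zero_iff, hM₀'mem, hM0]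
      intro τ
      have hd : τ • (m : localPoints W E) - m ∈ M := sub_mem (hMsmul τ m.2) m.2
      have hpd : p • (τ • (m : localPoints W E) - m) = 0 := by
        rw [smul_sub, ← galois_smul_nsmul, ← AddSubmonoidClass.coe_nsmul, hn τ, sub_self]
      exact sub_eq_zero.mp (hnt _ hd hpd)
  have hsep : ∀ z' : M ⧸ M₀' →+ ℤ_[p], (p : ℤ_[p]) ^ k' ∣ z' (QuotientAddGroup.mk ⟨x', hx'M⟩) := by
    intro z'
    have h := hdivAnn (z'.comp (QuotientAddGroup.mk' M₀')) (fun x hx ↦ by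
      rw [AddMonoidHom.comp_apply, QuotientAddGroup.mk'_apply,
        (QuotientAddGroup.eq_zero_iff _).mpr (hM₀'mem.mpr hx), map_zero])
    exact h
  obtain ⟨yq, hyq⟩ := Literature.Algebra.Module.exists_nsmul_eq_of_forall_addMonoidHom_padicInt_dvd hNtf hsep
  obtain ⟨R, rfl⟩ := QuotientAddGroup.mk_surjective yq
  rw [← QuotientAddGroup.mk_nsmul, QuotientAddGroup.eq, hM₀'mem] at hyq
  -- `x₀ := −p^{k'} R + x' ∈ E(K_v)`
  set x₀ : localPoints W E := -(p ^ k' • (R : localPoints W E)) + x' with hx₀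
  have hx₀0 : x₀ ∈ localLayerPointsOfEmb κ ι W 0 := by
    have : ((-(p ^ k' • R) + ⟨x', hx'M⟩ : M) : localPoints W E) = x₀ := by
      rw [AddSubgroup.coe_add, AddSubgroup.coe_neg, AddSubmonoidClass.coe_nsmul]
    rw [← this]; exact hyq
  -- Step 5: descent — `Q' := Q₁ − R`, `p^{k'} Q' = x₀`, and `f = ∂Q'` on all of `Γ_{K_v}`
  set Q' : localPoints W E := Q₁ - R with hQ'
  have hQ'k : p ^ k' • Q' = x₀ := by rw [hQ', smul_sub, ← hx', hx₀]; abel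
  have hfcob' : ∀ τ : Field.absoluteGaloisGroup E, τ ∈ localSubgroupOfEmb κ.kerSubgroup ι →
      f τ = τ • Q' - Q' := by
    intro τ hτ
    rw [hfcob τ hτ, hQ', smul_sub τ Q₁ (R : localPoints W E), hMfix R.2 τ hτ]
    abel
  have hfall : ∀ σ : Field.absoluteGaloisGroup E, f σ = σ • Q' - Q' := by
    intro σ
    -- `ψ := f σ − (σ Q' − Q')` is `G_∞`-fixed …
    have hψM : f σ - (σ • Q' - Q') ∈ M := by
      rw [hM, mem_localTowerPointsOfEmb_iff]
      intro τ hτ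
      have hτ' := hconj σ τ hτ
      have e1 : f (τ * σ) = f τ + τ • f σ := hfmul τ σ
      have e2 : f (τ * σ) = f σ + σ • f (σ⁻¹ * τ * σ) := by
        rw [show τ * σ = σ * (σ⁻¹ * τ * σ) by group]; exact hfmul σ _
      rw [hfcob' τ hτ] at e1
      rw [hfcob' _ hτ', smul_sub, ← mul_smul, show σ * (σ⁻¹ * τ * σ) = τ * σ by group, mul_smul] at e2
      have key := e1.symm.trans e2
      rw [smul_sub, smul_sub]
      calc τ • f σ - (τ • σ • Q' - τ • Q')
          = (τ • Q' - Q' + τ • f σ) - τ • σ • Q' + Q' := by abel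
        _ = (f σ + (τ • σ • Q' - σ • Q')) - τ • σ • Q' + Q' := by rw [key]
        _ = f σ - (σ • Q' - Q') := by abel
    -- … and `p`-power torsion: `p^{k'} ψ = p^{k'} f σ` (as `σ x₀ = x₀`), killed by `p^N`
    have hψtors : p ^ (N + k') • (f σ - (σ • Q' - Q')) = 0 := by
      have e1 : p ^ k' • (f σ - (σ • Q' - Q')) = p ^ k' • f σ := by
        rw [smul_sub, smul_sub, ← galois_smul_nsmul, hQ'k, (hM0.mp hx₀0) σ, sub_self, sub_zero]
      rw [pow_add, mul_smul, e1, smul_comm, hfN, smul_zero]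
    exact sub_eq_zero.mp (eq_zero_of_pow_smul_eq_zero W κ E hnt hψM hψtors)
  -- conclusion: `loc_v y` is the coboundary of `Q'`
  show oneCocycleClass _ Φ ∈ W.localKerOverOfEmb p (κ.layerSubgroup 0) ι
  refine localKummerOverOfEmb_le_localKerOverOfEmb (localLayerPointsOfEmb κ ι W 0) ⟨Φ, Q', k', rfl,
    by rw [hQ'k]; exact hx₀0, fun τ ↦ ?_⟩
  exact hfall τ

/-! ## §3 The two named facts over `ℚ`, from Sprung 2012 Prop. 7.3 / 7.6 / Lemma 2.3 -/

/-- The surjectivity hypothesis of the engine from the named facts Prop. 7.3 (`♭`) / Prop. 7.6 (`♯`).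
[cite: Sprung2012, Prop. 7.3 (p. 1500) and Prop. 7.6 (p. 1501)] -/
theorem colemanChromatic_surjective_of_prop73_prop76 (h73 : prop73_colemanFlat_surjective)
    (h76 : prop76_colemanSharp_surjective) (W : WeierstrassCurve ℚ) [W.IsElliptic] [W.IsGloballyMinimal]
    (p : ℕ) [Fact p.Prime] (hp2 : p ≠ 2) (hgood : W.HasGoodReductionAtPrime p)
    (hap : (p : ℤ) ∣ W.frobeniusTrace p) (κ : ZpExtension ℚ p) (hκ : κ.IsCyclotomic)
    (v : HeightOneSpectrum (𝓞 ℚ)) (hv : (p : 𝓞 ℚ) ∈ v.asIdeal)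
    (g : Field.absoluteGaloisGroup (v.adicCompletion ℚ))
    (hg : κ.IsTopGenerator (resGalOfEmb (closureEmb (K := ℚ) (v.adicCompletion ℚ)) g))
    (cneg : localPoints W (v.adicCompletion ℚ)) (c : ℕ → localPoints W (v.adicCompletion ℚ))
    (hH : IsHondaSystem κ (closureEmb (K := ℚ) (v.adicCompletion ℚ)) W (W.frobeniusTrace p) g cneg c)
    (col : Chroma) (f : IwasawaAlgebra p) :
    ∃ (w : localTowerPointsOfEmb κ (closureEmb (K := ℚ) (v.adicCompletion ℚ)) W →+ ℤ_[p])
      (Ls Lf : IwasawaAlgebra p),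
      IsColemanPair κ (closureEmb (K := ℚ) (v.adicCompletion ℚ)) W (W.frobeniusTrace p) g c w Ls Lf ∧
        chromaticL col Ls Lf = f := by
  cases col with
  | sharp =>
    obtain ⟨w, Lf, h⟩ := h76 W p hp2 hgood hap κ hκ v hv g hg cneg c hH f
    exact ⟨w, f, Lf, h, rfl⟩
  | flat =>
    obtain ⟨w, Ls, h⟩ := h73 W p hp2 hgood hap κ hκ v hv g hg cneg c hH f
    exact ⟨w, Ls, f, h, rfl⟩

/-- **`lem55AllN_sharpFlat_localKerOver_of_layerToInfty_mem` PROVED modulo Sprung 2012 Prop. 7.3,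
Prop. 7.6 (`η = 1`) and Lemma 2.3** (the every-conductor form of Sprung 2024 Lemma 5.5, case
`v = p`). [cite: Sprung2024, §5.2 proof of Lemma 5.5, case v = p (p. 40)]
[cite: Sprung2012, Prop. 7.3 (p. 1500), Prop. 7.6 (p. 1501), Lemma 2.3 (p. 1487)] -/
theorem lem55AllN_of_colemanSurjective (h73 : prop73_colemanFlat_surjective)
    (h76 : prop76_colemanSharp_surjective) (h23 : lem23_localTowerPoints_noPTorsion) :
    lem55AllN_sharpFlat_localKerOver_of_layerToInfty_mem := by
  intro W _ _ p _ hp2 hgood hap κ hκ v hv g hg cneg c hH col y hy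
  exact mem_localKerOver_of_layerToInfty_mem_sharpFlatLocalKummerOverOfEmb W κ (v.adicCompletion ℚ)
    hap hg hH col (colemanChromatic_surjective_of_prop73_prop76 h73 h76 W p hp2 hgood hap κ hκ v hv g
      hg cneg c hH col) (h23 W p hp2 hgood hap κ hκ v hv) hy

/-- **`lem55_sharpFlat_localKerOver_of_layerToInfty_mem` PROVED modulo Sprung 2012 Prop. 7.3,
Prop. 7.6 (`η = 1`) and Lemma 2.3** (the printed square-free form; `W.IsSemistable (𝓞 ℚ)` unused).
[cite: Sprung2024, §5.2 proof of Lemma 5.5, case v = p (p. 40)]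
[cite: Sprung2012, Prop. 7.3 (p. 1500), Prop. 7.6 (p. 1501), Lemma 2.3 (p. 1487)] -/
theorem lem55_of_colemanSurjective (h73 : prop73_colemanFlat_surjective)
    (h76 : prop76_colemanSharp_surjective) (h23 : lem23_localTowerPoints_noPTorsion) :
    lem55_sharpFlat_localKerOver_of_layerToInfty_mem := by
  intro W _ _ p _ hp2 _ hgood hap κ hκ v hv g hg cneg c hH col y hy
  exact lem55AllN_of_colemanSurjective h73 h76 h23 W p hp2 hgood hap κ hκ v hv g hg cneg c hH col y hy

end Literature.NumberTheory.EllipticCurves.Sprung2024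

end
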